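import Mathlib
import Summits.NavierStokesRegularity.NavierStokesRegularity.Theorems.FilamentSkeletonRssDefectColumnGateColumnModel
import Summits.NavierStokesRegularity.NavierStokesRegularity.Theorems.FilamentSkeletonRssDefectColumnGateVorticityForm
import Literature.Analysis.FluidPDE.BiotSavartCurlPair
import Literature.Analysis.FluidPDE.BurgersVortexSteady

/-!
# Route `FilamentSkeletonRss` · crux `TransverseReduction1AG` (stmt-NavierStokesRegularity-27853) · line `defect_column_gate_1AG` —
# THE VORTICITY OF THE FROZEN WAIST COLUMN and the EXPLICIT FORM OF THE S2a OPERATOR `colForceVort`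

Helper file (theorems only, `--supports stmt-NavierStokesRegularity-27853 --as helper`), second groundwork file for the kill-first #2 stub
S2a `WaistColumnGate1A` (LEAD of 27853, lane ns-filament-21221-p1 g10; the brief's «first helper targets»: `curl colSwirl = Gaussian·d` and
the reduction of `colForceVort`).  HONEST FRAMING: calculus identities about the MODEL base field of a HYPOTHETICAL filament-type
rotating-self-similar blow-up route (MODEL rung, negative side); no stub is proved; nothing here bears on Navier–Stokes regularity;
`TransverseReduction1AG` is neither proved nor refuted.

Notation: `q(y) = gam (|y|² − ⟨y,d⟩²)/4` (`= gam r²/4`, `r` the distance to the axis `ℝd` when `|d| = 1`), `φ = burgersPhi`,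
`c = gam·Rc/(8π)`, column swirl `S = colSwirl gam Rc d = (c φ(q)) · (d × y)`, base `U⁰_col = colBase B α gam Rc d = By − ½y + α e₃×y + S`.

* `hasFDerivAt_colSwirlCoeff`, `hasFDerivAt_colSwirl` — `D(c φ∘q)(y) = ⟨c φ′(q) (gam/2)(y − ⟨y,d⟩d), ·⟩` and the product rule for `S`;
* **`curl_colSwirl`** — for a UNIT axis `d`: `curl S (y) = (gam Rc/4π) e^{−q(y)} · d` — the Gaussian column of circulation `Rc`
  (`2c(φ(q) + qφ′(q)) = 2c e^{−q}`, the tree's `burgersPhi_add_mul_deriv`); `hasFDerivAt_colVorticity` — its derivative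
  `−(gam/2)(gam Rc/4π) e^{−q} ⟨y − ⟨y,d⟩d, ·⟩ d`;
* `curlCLM_id`, `hasFDerivAt_colBase`, **`curl_colBase`** — `curl U⁰_col (y) = curlCLM B + 2α e₃ + curl S (y)`: the UNIFORM BACKGROUND VORTICITY
  `Ω_bg := vec(B − Bᵀ) + 2α e₃` of the linear part plus the Gaussian column;
* **`colForceVort_eq`** — THE S2a OPERATOR WRITTEN OUT (`W ∈ C³` solenoidal, `U⁰_col` solenoidal, `|d| = 1`, `ω′ = curl W`, `Ω_S = curl S`):
  `colForceVort B α gam Rc d W = 3/2·ω′ − Bω′ + Dω′[By] − Δω′ + (Dω′[S] − DS[ω′] + DΩ_S[W] − DW[Ω_S]) − DW[Ω_bg]`.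
  READING: the frame rotation `α` and the Leray drift `½y·∇` have DROPPED OUT against the `α e₃×y − ½y` part of the base, except through
  the bounded zeroth-order tilting term `−DW[Ω_bg]`; what is left is the classical linearised operator of a Gaussian (Burgers-type) column
  of circulation `Rc` in the linear background flow `By` (stretching `−Bω′ + 3/2 ω′`, transport `Dω′[By]`), so the uniformity of S2a in the
  tilt of `d` against `e₃` and in `α` is uniformity in the background-vorticity vector `Ω_bg` (`|Ω_bg| ≤ C(Λ, θ₀)`) only.
-/

set_option linter.dupNamespace false

noncomputable section

namespace Summit.NavierStokesRegularity.NavierStokesRegularity.Theorems.DefectColumnGate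

open scoped BigOperators Topology InnerProductSpace Laplacian ContDiff
open Set Function
open Literature.Analysis.FluidPDE
open Summit.NavierStokesRegularity.NavierStokesRegularity.Theorems.KelvinGate

/-! ## 1. The column swirl: derivative and vorticity -/

/-- Derivative of the scalar factor `c φ(q(y))` of the column swirl: `D(c φ∘q)(y) = ⟨c φ′(q(y)) (gam/2) (y − ⟨y,d⟩ d), ·⟩`. -/
theorem hasFDerivAt_colSwirlCoeff (gam Rc : ℝ) (d y : EuclideanSpace ℝ (Fin 3)) :
    HasFDerivAt (fun y : EuclideanSpace ℝ (Fin 3) => gam * Rc / (8 * Real.pi) * burgersPhi (gam * (‖y‖ ^ 2 - ⟪y, d⟫_ℝ ^ 2) / 4))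
      (innerSL ℝ ((gam * Rc / (8 * Real.pi) * deriv burgersPhi (gam * (‖y‖ ^ 2 - ⟪y, d⟫_ℝ ^ 2) / 4) * (gam / 2)) •
        (y - ⟪y, d⟫_ℝ • d))) y := by
  have hq := hasFDerivAt_colSwirlArg gam d y
  have hφ : HasDerivAt burgersPhi (deriv burgersPhi (gam * (‖y‖ ^ 2 - ⟪y, d⟫_ℝ ^ 2) / 4))
      (gam * (‖y‖ ^ 2 - ⟪y, d⟫_ℝ ^ 2) / 4) := StrainedAzimuthal.hasDerivAt_burgersPhi _
  have h := (hφ.comp_hasFDerivAt y hq).const_mul (gam * Rc / (8 * Real.pi))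
  refine h.congr_fderiv (ContinuousLinearMap.ext fun v => ?_)
  rw [innerSL_apply_apply, real_inner_smul_left, inner_sub_left, real_inner_smul_left,
    show ∀ (c₁ c₂ c₃ c₄ c₅ : ℝ) (L₁ L₂ : EuclideanSpace ℝ (Fin 3) →L[ℝ] ℝ) (w : EuclideanSpace ℝ (Fin 3)),
      (c₁ • (c₂ • (c₃ • (c₄ • L₁ - c₅ • L₂)))) w = c₁ * (c₂ * (c₃ * (c₄ * L₁ w - c₅ * L₂ w))) from fun _ _ _ _ _ _ _ _ => rfl,
    innerSL_apply_apply, innerSL_apply_apply]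
  ring

/-- **Product rule for the column swirl**: `DS(y) h = ⟨g(y), h⟩ (d × y) + c φ(q(y)) (d × h)` with `g(y) = c φ′(q) (gam/2)(y − ⟨y,d⟩d)`. -/
theorem hasFDerivAt_colSwirl (gam Rc : ℝ) (d y : EuclideanSpace ℝ (Fin 3)) :
    HasFDerivAt (colSwirl gam Rc d)
      ((gam * Rc / (8 * Real.pi) * burgersPhi (gam * (‖y‖ ^ 2 - ⟪y, d⟫_ℝ ^ 2) / 4)) • crossCLM d +
        (innerSL ℝ ((gam * Rc / (8 * Real.pi) * deriv burgersPhi (gam * (‖y‖ ^ 2 - ⟪y, d⟫_ℝ ^ 2) / 4) * (gam / 2)) •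
          (y - ⟪y, d⟫_ℝ • d))).smulRight (cross d y)) y := by
  rw [colSwirl_eq]
  exact (hasFDerivAt_colSwirlCoeff gam Rc d y).smul ((crossCLM d).hasFDerivAt (x := y))

/-- `⟨d, d⟩ = 1` for a unit vector. -/
theorem real_inner_self_eq_one_of_norm {d : EuclideanSpace ℝ (Fin 3)} (hd : ‖d‖ = 1) : ⟪d, d⟫_ℝ = 1 := by
  rw [real_inner_self_eq_norm_sq, hd]; norm_num

/-- The sectional gradient `y − ⟨y,d⟩ d` is orthogonal to the unit axis `d` … -/
theorem inner_sub_proj_axis {d : EuclideanSpace ℝ (Fin 3)} (hd : ‖d‖ = 1) (y : EuclideanSpace ℝ (Fin 3)) :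
    ⟪y - ⟪y, d⟫_ℝ • d, d⟫_ℝ = 0 := by
  rw [inner_sub_left, real_inner_smul_left, real_inner_self_eq_one_of_norm hd]; ring

/-- … and pairs with `y` to the squared distance to the axis `|y|² − ⟨y,d⟩²`. -/
theorem inner_sub_proj_self (d y : EuclideanSpace ℝ (Fin 3)) :
    ⟪y - ⟪y, d⟫_ℝ • d, y⟫_ℝ = ‖y‖ ^ 2 - ⟪y, d⟫_ℝ ^ 2 := by
  rw [inner_sub_left, real_inner_smul_left, real_inner_self_eq_norm_sq, real_inner_comm d y]; ring

/-- The curl of the linear field `y ↦ d × y` is `2d` (as a field statement). -/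
theorem curl_crossCLM (d y : EuclideanSpace ℝ (Fin 3)) : curl (fun z : EuclideanSpace ℝ (Fin 3) => crossCLM d z) y = (2:ℝ) • d := by
  rw [curl_eq_curlCLM, show (fun z : EuclideanSpace ℝ (Fin 3) => crossCLM d z) = (crossCLM d : _ → _) from rfl,
    ContinuousLinearMap.fderiv, curlCLM_crossCLM]

/-- **THE VORTICITY OF THE GAUSSIAN COLUMN SWIRL** (unit axis `d`): `curl (colSwirl gam Rc d)(y) = (gam·Rc/4π) e^{−gam(|y|²−⟨y,d⟩²)/4} · d` —
a Gaussian vortex column of circulation `Rc` and Gaussian parameter `gam` along `d` (for `d = e₃` this is the tree's `curl_burgersVortexSwirl`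
with viscosity `1`).  Proof: `curl(θ·(d×y)) = 2θ d + ∇θ × (d×y)`, `∇θ × (d × y) = ⟨∇θ, y⟩ d − ⟨∇θ, d⟩ y = 2c q φ′(q) d`, and
`φ(q) + qφ′(q) = e^{−q}`. -/
theorem curl_colSwirl (gam Rc : ℝ) {d : EuclideanSpace ℝ (Fin 3)} (hd : ‖d‖ = 1) (y : EuclideanSpace ℝ (Fin 3)) :
    curl (colSwirl gam Rc d) y =
      (gam * Rc / (4 * Real.pi) * Real.exp (-(gam * (‖y‖ ^ 2 - ⟪y, d⟫_ℝ ^ 2) / 4))) • d := by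
  rw [colSwirl_eq]
  have hθ := hasFDerivAt_colSwirlCoeff gam Rc d y
  have hu : DifferentiableAt ℝ (fun y : EuclideanSpace ℝ (Fin 3) => crossCLM d y) y := (crossCLM d).differentiableAt
  rw [curl_smul hθ.differentiableAt hu, hθ.fderiv, curl_crossCLM, crossCLM_apply, curlCLM_smulRight_innerSL, cross_cross_right,
    real_inner_smul_left, real_inner_smul_left, inner_sub_proj_axis hd, inner_sub_proj_self, mul_zero, zero_smul, sub_zero,
    smul_smul, ← add_smul]
  congr 1
  have hphi := StrainedAzimuthal.burgersPhi_add_mul_deriv (gam * (‖y‖ ^ 2 - ⟪y, d⟫_ℝ ^ 2) / 4)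
  rw [← hphi]
  ring

/-- `curl_colSwirl` as an equality of fields. -/
theorem curl_colSwirl_eq (gam Rc : ℝ) {d : EuclideanSpace ℝ (Fin 3)} (hd : ‖d‖ = 1) :
    curl (colSwirl gam Rc d) =
      fun y => (gam * Rc / (4 * Real.pi) * Real.exp (-(gam * (‖y‖ ^ 2 - ⟪y, d⟫_ℝ ^ 2) / 4))) • d :=
  funext fun y => curl_colSwirl gam Rc hd y

/-- **Derivative of the column vorticity** `Ω_S(y) = ζ(y) d`, `ζ = (gam Rc/4π)e^{−q}`: `DΩ_S(y) h = −(gam/2) ζ(y) ⟨y − ⟨y,d⟩d, h⟩ · d`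
(radial Gaussian decay across the column, no variation along it). -/
theorem hasFDerivAt_colVorticity (gam Rc : ℝ) (d y : EuclideanSpace ℝ (Fin 3)) :
    HasFDerivAt (fun y : EuclideanSpace ℝ (Fin 3) => (gam * Rc / (4 * Real.pi) * Real.exp (-(gam * (‖y‖ ^ 2 - ⟪y, d⟫_ℝ ^ 2) / 4))) • d)
      ((innerSL ℝ ((-(gam * Rc / (4 * Real.pi) * Real.exp (-(gam * (‖y‖ ^ 2 - ⟪y, d⟫_ℝ ^ 2) / 4)) * (gam / 2))) •
        (y - ⟪y, d⟫_ℝ • d))).smulRight d) y := by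
  have hq := hasFDerivAt_colSwirlArg gam d y
  have hexp : HasDerivAt (fun t : ℝ => Real.exp (-t)) (-Real.exp (-(gam * (‖y‖ ^ 2 - ⟪y, d⟫_ℝ ^ 2) / 4)))
      (gam * (‖y‖ ^ 2 - ⟪y, d⟫_ℝ ^ 2) / 4) := by
    simpa using ((hasDerivAt_neg (gam * (‖y‖ ^ 2 - ⟪y, d⟫_ℝ ^ 2) / 4)).exp)
  have h := ((hexp.comp_hasFDerivAt y hq).const_mul (gam * Rc / (4 * Real.pi))).smul_const d
  refine h.congr_fderiv (ContinuousLinearMap.ext fun v => ?_)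
  rw [ContinuousLinearMap.smulRight_apply, ContinuousLinearMap.smulRight_apply, innerSL_apply_apply, real_inner_smul_left,
    inner_sub_left, real_inner_smul_left,
    show ∀ (c₁ c₂ c₃ c₄ c₅ : ℝ) (L₁ L₂ : EuclideanSpace ℝ (Fin 3) →L[ℝ] ℝ) (w : EuclideanSpace ℝ (Fin 3)),
      (c₁ • (c₂ • (c₃ • (c₄ • L₁ - c₅ • L₂)))) w = c₁ * (c₂ * (c₃ * (c₄ * L₁ w - c₅ * L₂ w))) from fun _ _ _ _ _ _ _ _ => rfl,
    innerSL_apply_apply, innerSL_apply_apply]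
  congr 1
  ring

/-! ## 2. The frozen waist model base: derivative and vorticity -/

/-- The identity matrix has no axial vector: `curlCLM id = 0`. -/
theorem curlCLM_id : curlCLM (ContinuousLinearMap.id ℝ (EuclideanSpace ℝ (Fin 3))) = 0 := by
  rw [curlCLM_apply]
  ext i
  fin_cases i <;> simp

/-- The base as «linear part + column swirl»: `U⁰_col = (B − ½ id + α J) + S`. -/
theorem colBase_eq_linear_add_colSwirl (B : EuclideanSpace ℝ (Fin 3) →L[ℝ] EuclideanSpace ℝ (Fin 3)) (α gam Rc : ℝ)
    (d : EuclideanSpace ℝ (Fin 3)) :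
    colBase B α gam Rc d = fun y =>
      (B - (1/2:ℝ) • ContinuousLinearMap.id ℝ (EuclideanSpace ℝ (Fin 3)) + α • crossCLM (EuclideanSpace.single 2 1)) y +
        colSwirl gam Rc d y := by
  funext y
  simp only [colBase, _root_.add_apply, _root_.sub_apply, _root_.smul_apply, ContinuousLinearMap.id_apply, crossCLM_apply]

/-- **Derivative of the base**: `DU⁰_col(y) = B − ½ id + α J + DS(y)`. -/
theorem hasFDerivAt_colBase (B : EuclideanSpace ℝ (Fin 3) →L[ℝ] EuclideanSpace ℝ (Fin 3)) (α gam Rc : ℝ) (d y : EuclideanSpace ℝ (Fin 3)) :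
    HasFDerivAt (colBase B α gam Rc d)
      (B - (1/2:ℝ) • ContinuousLinearMap.id ℝ (EuclideanSpace ℝ (Fin 3)) + α • crossCLM (EuclideanSpace.single 2 1) +
        fderiv ℝ (colSwirl gam Rc d) y) y := by
  rw [colBase_eq_linear_add_colSwirl]
  have hS : DifferentiableAt ℝ (colSwirl gam Rc d) y := ((contDiff_colSwirl gam Rc d (n := 1)).differentiable (by norm_num)) y
  exact ((B - (1/2:ℝ) • ContinuousLinearMap.id ℝ (EuclideanSpace ℝ (Fin 3)) +
    α • crossCLM (EuclideanSpace.single 2 1)).hasFDerivAt).fun_add hS.hasFDerivAt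

/-- **THE VORTICITY OF THE FROZEN WAIST MODEL BASE**: `curl U⁰_col (y) = curlCLM B + 2α e₃ + curl S (y)` — the uniform background vorticity
`Ω_bg = vec(B − Bᵀ) + 2α e₃` of the linear part `By − ½y + α e₃×y` (the dilation `−½y` is curl free) plus the column. -/
theorem curl_colBase (B : EuclideanSpace ℝ (Fin 3) →L[ℝ] EuclideanSpace ℝ (Fin 3)) (α gam Rc : ℝ) (d y : EuclideanSpace ℝ (Fin 3)) :
    curl (colBase B α gam Rc d) y = curlCLM B + (2 * α) • EuclideanSpace.single 2 1 + curl (colSwirl gam Rc d) y := by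
  rw [colBase_eq_linear_add_colSwirl]
  have hS : DifferentiableAt ℝ (colSwirl gam Rc d) y := ((contDiff_colSwirl gam Rc d (n := 1)).differentiable (by norm_num)) y
  have hL : DifferentiableAt ℝ (fun y : EuclideanSpace ℝ (Fin 3) =>
      (B - (1/2:ℝ) • ContinuousLinearMap.id ℝ (EuclideanSpace ℝ (Fin 3)) + α • crossCLM (EuclideanSpace.single 2 1)) y) y :=
    (B - (1/2:ℝ) • ContinuousLinearMap.id ℝ (EuclideanSpace ℝ (Fin 3)) + α • crossCLM (EuclideanSpace.single 2 1)).differentiableAt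
  rw [curl_add hL hS, curl_eq_curlCLM,
    show (fun y : EuclideanSpace ℝ (Fin 3) =>
        (B - (1/2:ℝ) • ContinuousLinearMap.id ℝ (EuclideanSpace ℝ (Fin 3)) + α • crossCLM (EuclideanSpace.single 2 1)) y) =
      ((B - (1/2:ℝ) • ContinuousLinearMap.id ℝ (EuclideanSpace ℝ (Fin 3)) + α • crossCLM (EuclideanSpace.single 2 1) :
        EuclideanSpace ℝ (Fin 3) →L[ℝ] EuclideanSpace ℝ (Fin 3)) : _ → _) from rfl,
    ContinuousLinearMap.fderiv, map_add, map_sub, map_smul, map_smul, curlCLM_id, curlCLM_crossCLM, smul_zero, sub_zero, smul_smul,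
    mul_comm α 2]

/-- `curl_colBase` with the Gaussian column written out (unit axis). -/
theorem curl_colBase_of_norm (B : EuclideanSpace ℝ (Fin 3) →L[ℝ] EuclideanSpace ℝ (Fin 3)) (α gam Rc : ℝ) {d : EuclideanSpace ℝ (Fin 3)}
    (hd : ‖d‖ = 1) (y : EuclideanSpace ℝ (Fin 3)) :
    curl (colBase B α gam Rc d) y =
      curlCLM B + (2 * α) • EuclideanSpace.single 2 1 +
        (gam * Rc / (4 * Real.pi) * Real.exp (-(gam * (‖y‖ ^ 2 - ⟪y, d⟫_ℝ ^ 2) / 4))) • d := by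
  rw [curl_colBase, curl_colSwirl gam Rc hd y]

/-- As fields: `curl U⁰_col = Ω_bg + curl S`. -/
theorem curl_colBase_eq (B : EuclideanSpace ℝ (Fin 3) →L[ℝ] EuclideanSpace ℝ (Fin 3)) (α gam Rc : ℝ) (d : EuclideanSpace ℝ (Fin 3)) :
    curl (colBase B α gam Rc d) = fun y => curlCLM B + (2 * α) • EuclideanSpace.single 2 1 + curl (colSwirl gam Rc d) y :=
  funext fun y => curl_colBase B α gam Rc d y

/-- The derivative of the base vorticity is the derivative of the column vorticity (the background part is constant). -/
theorem fderiv_curl_colBase (B : EuclideanSpace ℝ (Fin 3) →L[ℝ] EuclideanSpace ℝ (Fin 3)) (α gam Rc : ℝ) (d y : EuclideanSpace ℝ (Fin 3)) :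
    fderiv ℝ (curl (colBase B α gam Rc d)) y = fderiv ℝ (curl (colSwirl gam Rc d)) y := by
  rw [curl_colBase_eq]
  exact fderiv_const_add _

/-! ## 3. The S2a operator written out -/

/-- **THE S2a OPERATOR `colForceVort` WRITTEN OUT.**  For a unit axis is not even needed here: for ANY `d`, any `B, α, gam, Rc` with the base
`U⁰_col = colBase B α gam Rc d` divergence free (tree: `isDivFree_colBase` under the S2a frame hypotheses), and any solenoidal `W ∈ C³`,
with `ω′ = curl W`, `S = colSwirl gam Rc d`, `Ω_S = curl S`, `Ω_bg = curlCLM B + 2α e₃`: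
`colForceVort B α gam Rc d W (y) = 3/2·ω′ − Bω′ + Dω′[By] − Δω′ + (Dω′[S y] − DS(y)[ω′] + DΩ_S(y)[W y] − DW(y)[Ω_S y]) − DW(y)[Ω_bg]`.
The frame-rotation terms `α(e₃×ω′ − Dω′[e₃×y])` of `curl ∘ 𝓛` cancel EXACTLY against transport/stretching by the `α e₃×y` part of the base,
and the Leray drift `½Dω′[y]` against transport by `−½y`; `α` survives only inside the constant background vorticity `Ω_bg`. -/
theorem colForceVort_eq {B : EuclideanSpace ℝ (Fin 3) →L[ℝ] EuclideanSpace ℝ (Fin 3)} {α gam Rc : ℝ} {d : EuclideanSpace ℝ (Fin 3)}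
    (hdivU : VectorCalculus.IsDivFree (colBase B α gam Rc d))
    {W : EuclideanSpace ℝ (Fin 3) → EuclideanSpace ℝ (Fin 3)} (hW : ContDiff ℝ 3 W) (hdivW : VectorCalculus.IsDivFree W)
    (y : EuclideanSpace ℝ (Fin 3)) :
    colForceVort B α gam Rc d W y =
      (3/2:ℝ) • curl W y - B (curl W y) + fderiv ℝ (curl W) y (B y) - (Δ (curl W)) y
        + (fderiv ℝ (curl W) y (colSwirl gam Rc d y) - fderiv ℝ (colSwirl gam Rc d) y (curl W y)
            + fderiv ℝ (curl (colSwirl gam Rc d)) y (W y) - fderiv ℝ W y (curl (colSwirl gam Rc d) y))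
        - fderiv ℝ W y (curlCLM B + (2 * α) • EuclideanSpace.single 2 1) := by
  have hU2 : ContDiff ℝ 2 (colBase B α gam Rc d) := contDiff_colBase B α gam Rc d
  unfold colForceVort
  rw [curl_lerayLin_of_isDivFree α hU2 hW hdivU hdivW y, fderiv_curl_colBase, curl_colBase, (hasFDerivAt_colBase B α gam Rc d y).fderiv]
  rw [show colBase B α gam Rc d y = B y - (1/2:ℝ) • y + α • cross (EuclideanSpace.single 2 1) y + colSwirl gam Rc d y from rfl]
  simp only [map_add, map_sub, map_smul, _root_.add_apply, _root_.sub_apply, _root_.smul_apply, ContinuousLinearMap.id_apply,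
    crossCLM_apply]
  module

/-- **The S2a operator, unit-axis form**: as `colForceVort_eq` with the column vorticity `Ω_S = (gam Rc/4π)e^{−q}·d` and its derivative
written out (`curl_colSwirl`, `hasFDerivAt_colVorticity`). -/
theorem colForceVort_eq_of_norm {B : EuclideanSpace ℝ (Fin 3) →L[ℝ] EuclideanSpace ℝ (Fin 3)} {α gam Rc : ℝ} {d : EuclideanSpace ℝ (Fin 3)}
    (hd : ‖d‖ = 1) (hdivU : VectorCalculus.IsDivFree (colBase B α gam Rc d))
    {W : EuclideanSpace ℝ (Fin 3) → EuclideanSpace ℝ (Fin 3)} (hW : ContDiff ℝ 3 W) (hdivW : VectorCalculus.IsDivFree W)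
    (y : EuclideanSpace ℝ (Fin 3)) :
    colForceVort B α gam Rc d W y =
      (3/2:ℝ) • curl W y - B (curl W y) + fderiv ℝ (curl W) y (B y) - (Δ (curl W)) y
        + (fderiv ℝ (curl W) y (colSwirl gam Rc d y) - fderiv ℝ (colSwirl gam Rc d) y (curl W y)
            + (-(gam * Rc / (4 * Real.pi) * Real.exp (-(gam * (‖y‖ ^ 2 - ⟪y, d⟫_ℝ ^ 2) / 4)) * (gam / 2)) *
                ⟪y - ⟪y, d⟫_ℝ • d, W y⟫_ℝ) • d
            - (gam * Rc / (4 * Real.pi) * Real.exp (-(gam * (‖y‖ ^ 2 - ⟪y, d⟫_ℝ ^ 2) / 4))) • fderiv ℝ W y d)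
        - fderiv ℝ W y (curlCLM B + (2 * α) • EuclideanSpace.single 2 1) := by
  rw [colForceVort_eq hdivU hW hdivW y, curl_colSwirl_eq gam Rc hd, (hasFDerivAt_colVorticity gam Rc d y).fderiv,
    ContinuousLinearMap.smulRight_apply, innerSL_apply_apply, real_inner_smul_left, map_smul]

end Summit.NavierStokesRegularity.NavierStokesRegularity.Theorems.DefectColumnGate

end
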